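import Summits.BirchSwinnertonDyer.BirchSwinnertonDyer.Theorems.ManinLocalTwoThreeManinConstantOneTwenty
import Summits.BirchSwinnertonDyer.BirchSwinnertonDyer.Theorems.ManinLocalTwoThreeTwistFamiliesFactFree
import HarnessLib

/-!
# Twist root `120`: `LevelManinOne 120` (verbatim from the level file) and its odd twist images

Cell bsd-f2-manin, route `ManinLocalTwoThree` (cruxes C2 `ManinOddAtFour` stmt-22967 / C3 `ManinPrimeToThreeAtNine` stmt-22968), prover seat p3 gen 26;
the twin of `…TwistRootsOneTwentySix` / `…TwistRootsNinetyOneSixtyTwoOneEighty` for this seat's fifth complete level: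
`LevelOneTwenty.abs_maninConstant_eq_one_oneTwenty` (`120 = 2³·3·5`, classes `120a`, `120b`; an g56's `S₂`-pinning + staged Bracket–Sturm certificates at
depth 289) is verbatim `LevelManinOne 120`, and the tree's engine (THEOREM 68.A, `twistLevelManinOne_of_levelManinOne`) gives `|c| = 1` on its `χ_p`-twist images
for every odd prime `p` (root datum good or multiplicative at `p`; e.g. `p = 3`: level `360 = 2³·3²·5`, in BOTH crux domains; `p = 5`: level `600`).  `8 ∥ 120`, so the
root is NOT `2`-multiplicative and no dyadic image is recorded.

HONEST SCOPE.  The statements cover exactly the twist images (hypotheses as in the engine).  Nothing here proves C2, C3 (∀ N), the rung, Manin's conjecture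
or BSD; items 22967/22968 stay OPEN.  No definition, no named fact, no sorry.
[cite: Stevens1989, Lemma (5.2), (5.4)] [cite: Pal2012, Prop. 2.4] [cite: CremonaAlgorithms1997, Table 1 (120)]
-/

set_option autoImplicit false
-- lint-debt: the directory name repeats the summit name (sibling precedent `ManinLocalTwoThreeTwistRootsOneTwentySix.lean`)
set_option linter.dupNamespace false

noncomputable section

open Complex
open scoped MatrixGroups ModularForm
open ModularForm CongruenceSubgroup
open Literature.NumberTheory.EllipticCurves Literature.NumberTheory.EllipticCurves.ModularForms
open Summit.BirchSwinnertonDyer.BirchSwinnertonDyer.Theorems.ManinLocalTwoThree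

namespace Summit.BirchSwinnertonDyer.BirchSwinnertonDyer.Theorems.ManinLocalTwoThree.TwistRootsOneTwenty

open WeierstrassCurve TwistFamilies

/-- **`LevelManinOne 120`** — level `120 = 2³·3·5` (classes `120a`, `120b`: `S₂`-pinning bridge + staged Bracket–Sturm certificates) is COMPLETE, fact-free (p3 g26).
[cite: CremonaAlgorithms1997, Table 1 (120)] -/
theorem levelManinOne_oneTwenty : LevelManinOne 120 :=
  fun W _ _ D h ↦ LevelOneTwenty.abs_maninConstant_eq_one_oneTwenty W D h

/-- **`TwistLevelManinOne 120 p` for every odd prime `p`** (THEOREM 68.A on the root `120`; `p = 3` is the level `360`, `p = 5` the level `600`).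
[cite: Stevens1989, Lemma (5.2), (5.4)] -/
theorem twistLevelManinOne_oneTwenty {p : ℕ} [Fact p.Prime] (hp2 : p ≠ 2) : TwistLevelManinOne 120 p :=
  twistLevelManinOne_of_levelManinOne levelManinOne_oneTwenty hp2

end Summit.BirchSwinnertonDyer.BirchSwinnertonDyer.Theorems.ManinLocalTwoThree.TwistRootsOneTwenty

end
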